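import Summits.QuantumFields.YangMills.Theorems.LatticeGapOnTrajectory.Negative.ZeroCoupling
import Summits.QuantumFields.YangMills.Theses.ParabolicTrajectory
import Literature.Probability.LatticeModels.GibbsSpecification
import Literature.MathematicalPhysics.QuantumFieldTheory.YangMillsOS
import Mathlib.Probability.Moments.Covariance
import Summits.QuantumFields.YangMills.Theorems.ParabolicTrajectoryLatticeGapOnTrajectoryDefs
import Summits.QuantumFields.YangMills.Theorems.ParabolicTrajectoryLatticeGapOnTrajectoryStubSmoothingToGapHelpers

/-!
# Route `ParabolicTrajectory`, crux `LatticeGapOnTrajectory` (stmt-QuantumFields-10523), line `orbit-kantorovich-finite-size`: stub `stub_smoothingToGap` — deployment on the symmetric torus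

Given the Dobrushin–Shlosman/Kantorovich ENGINE (`KREngine`), the torus frames (`TorusFramesExist`), the
window-averaging toolkit (`SpecificationTower`), the DLR description of Wilson's torus measure
(`WilsonTorusDLR`) and the orbit–Kantorovich windows along the scheme (`OrbitKRWindowsAlong`), the
crux's lattice half `HasLatticeMassGap r sch Δ` holds with `Δ = κ(n₀, γ₀, 1) / (4t)`.

* §A `cdist`: component bound, symmetry, `cdist x x = 0`, triangle inequality (`ZMod.valMinAbs`).
* §B `dependsOn_of_cellwise`: single-cell invariance on a finite set of cells ⇒ dependence off those cells.
* §C `abs_corr_le_two_mul`: the trivial bound `2‖f‖‖g‖` (near case).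
* §D `abs_corr_le_far`: the TOWER identity `cov(f, g) = cov(γ_{W_A} f, γ_{W_B} g)` and the engine (far case),
  for an abstract specification read on cells.
* §E `abs_latticeConnectedCorr_le`: one torus, one time separation: frames adapted to the two supports,
  near/far split, exponent bookkeeping.
* §F `stub_smoothingToGap`: the eventualities in `k` and the `k`-uniform constant.
-/


/-! This is the STUB half: the one-torus bound `abs_latticeConnectedCorr_le` and the registered stub `stub_smoothingToGap`; the G-blind
helpers are in `…StubSmoothingToGapHelpers.lean`. -/

namespace Summit.QuantumFields.YangMills.Cruxes.LatticeGapOnTrajectory.OrbitKantorovichFiniteSize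

open scoped BigOperators Topology ENNReal ProbabilityTheory
open Filter MeasureTheory
open Literature.Probability.LatticeModels (Specification IsSpecification IsGibbsMeasure glueWith)
open Literature.MathematicalPhysics.QuantumFieldTheory
open Literature.MathematicalPhysics.QuantumLattice
open Summit.QuantumFields.YangMills.Theorems.LatticeGapOnTrajectory.Negative

noncomputable section

section Torus

variable {G : Type} [Group G] [TopologicalSpace G] [IsTopologicalGroup G] [CompactSpace G]
  [MeasurableSpace G] [BorelSpace G]

/-- **On one torus.** Fix a torus side `N`, a cell scale `b` with `4w + 4 ≤ b`, `(2n₀+3)·2b ≤ N`, a time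
separation `m < N/2`, two species `A`, `B` whose supports have at most `s` edges with base points in the cube
`[-w, w]⁴`, the DLR description of Wilson's torus measure at coupling `β`, and the physics input (KR window
package + rough-centre bound for EVERY family of axis frames of scale `b` with `≥ 2n₀ + 3` cells per axis).
Frames are chosen axis by axis (`TorusFramesExist.2`) so that the torus images of `supp A` and of
`supp τ_m B` each lie in ONE cell `c_A`, `c_B`; by coarse-Lipschitzness of the time frame
(`TorusFramesExist.1`) `m ≤ 2b (cdist c_A c_B + 1)`. Near case `cdist ≤ 2n₀ + 2`: the trivial bound. Far
case: `abs_corr_le_far`. Either way `|⟨A ; τ_m B⟩| ≤ (2‖A‖‖B‖ + C₀ |K_s‖A‖| |K_s‖B‖|) e^{κ(2n₀+3)/2} e^{-x}`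
for every `x ≤ κ m / (4 b)`. -/
theorem abs_latticeConnectedCorr_le (hTF : TorusFramesExist) (hT : SpecificationTower)
    {n₀ : ℕ} {γ₀ κ C₀ : ℝ} (hκ : 0 ≤ κ) (hC₀ : 0 ≤ C₀)
    (hEng : ∀ (μ : Fin 4 → ℕ) (V S : Type) [Fintype V] [MeasurableSpace S]
      (cell : V → CoarseIdx μ) (w : CoarseIdx μ → (V → S) → (V → S) → ℝ)
      (γ : Specification V S) (k : CoarseIdx μ → CoarseIdx μ → CoarseIdx μ → ℝ),
      (∀ i, 2 * n₀ + 3 ≤ μ i + 1) → IsSpecification γ → IsKRWindow cell w γ 1 n₀ γ₀ k →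
      ∀ ν : Measure (V → S), IsGibbsMeasure γ ν →
      ∀ (f g : (V → S) → ℝ) (Δf Δg : Finset (CoarseIdx μ)) (δf δg : CoarseIdx μ → ℝ) (D : ℕ),
        Measurable f → Measurable g → (∃ B, ∀ σ, |f σ| ≤ B) → (∃ B, ∀ σ, |g σ| ≤ B) →
        DependsOn f {v | cell v ∈ Δf} → DependsOn g {v | cell v ∈ Δg} →
        IsCellLipBound cell w f δf → IsCellLipBound cell w g δg →
        (∀ x ∈ Δf, ∀ y ∈ Δg, D ≤ cdist x y) →
          |cov[f, g; ν]| ≤ C₀ * (∑ x ∈ Δf, δf x) * (∑ y ∈ Δg, δg y) * Real.exp (-(κ * D)))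
    (r : LatticeRep G) (β α Ks : ℝ) (s N b w m : ℕ) [NeZero N]
    (A B : YMSpecies G) {CA CB : ℝ} (hCA : ∀ U, |A.F U| ≤ CA) (hCB : ∀ U, |B.F U| ≤ CB)
    (hsA : A.supp.card ≤ s) (hsB : B.supp.card ≤ s)
    (hwA : ∀ e ∈ A.supp, ∀ i, |e.1 i| ≤ (w : ℤ)) (hwB : ∀ e ∈ B.supp, ∀ i, |e.1 i| ≤ (w : ℤ))
    (hb1 : 1 ≤ b) (hb4 : 4 * w + 4 ≤ b) (hbN : (2 * n₀ + 3) * (2 * b) ≤ N) (hmN : 2 * m < N)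
    (hγ : IsSpecification (torusYM r.ρ β N))
    (hGibbs : IsGibbsMeasure (torusYM r.ρ β N) (wilsonMeasure (d := 4) (L := N) r.ρ β))
    (hphys : ∀ (μ : Fin 4 → ℕ) (q : (i : Fin 4) → ZMod N → ZMod (μ i + 1)),
        (∀ i, 2 * n₀ + 3 ≤ μ i + 1) → (∀ i, IsTorusFrame N b (q i)) →
          (∃ kp : CoarseIdx μ → CoarseIdx μ → CoarseIdx μ → ℝ,
              IsKRWindow (cellOf q) (orbitWeight r α q) (torusYM r.ρ β N) 1 n₀ γ₀ kp) ∧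
          RoughCentreBound r β N q α n₀ s Ks)
    {x : ℝ} (hx : x ≤ κ * m / (4 * b)) :
    |latticeConnectedCorr r.ρ β N A.F B.F m| ≤
      (2 * (CA * CB) + C₀ * |Ks * CA| * |Ks * CB|) * Real.exp (κ * (2 * n₀ + 3) / 2) *
        Real.exp (-x) := by
  classical
  haveI : IsProbabilityMeasure (wilsonMeasure (d := 4) (L := N) r.ρ β) := hGibbs.1
  have hCA0 : 0 ≤ CA := (abs_nonneg _).trans (hCA 1)
  have hCB0 : 0 ≤ CB := (abs_nonneg _).trans (hCB 1)
  -- the second prescribed centre on each axis: the time shift `m e₀` read mod `N`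
  set x₂ : Fin 4 → ZMod N :=
    Literature.Probability.LatticeModels.Torus.proj N (Pi.single 0 (m : ℤ)) with hx₂
  -- frames, axis by axis
  have hfr : ∀ i : Fin 4, ∃ (μi : ℕ) (qi : ZMod N → ZMod (μi + 1)), 2 * n₀ + 3 ≤ μi + 1 ∧
      IsTorusFrame N b qi ∧ (∀ j : ℕ, j ≤ 2 * w → qi (0 - (w : ZMod N) + (j : ZMod N)) = qi 0) ∧
      (∀ j : ℕ, j ≤ 2 * w → qi (x₂ i - (w : ZMod N) + (j : ZMod N)) = qi (x₂ i)) :=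
    fun i => hTF.2 n₀ N b w 0 (x₂ i) inferInstance hb1 hb4 hbN
  choose μ q hμ hframe harcA harcB using hfr
  obtain ⟨⟨kp, hKR⟩, hRC⟩ := hphys μ q hμ hframe
  -- the time translation vector `-m e₀` and the two observables on the torus
  set v : Literature.Probability.LatticeModels.Site 4 := -Pi.single 0 (m : ℤ) with hv
  set f : GaugeConfig 4 N G → ℝ := fun U => A.F (torusLift N U) with hf
  set g : GaugeConfig 4 N G → ℝ := fun U => B.F (configShift v (torusLift N U)) with hg
  have hfm : Measurable f := A.measurable.comp (measurable_torusLift N)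
  have hgm : Measurable g :=
    B.measurable.comp ((configShift _).measurable.comp (measurable_torusLift N))
  have hfb : ∀ U, |f U| ≤ CA := fun U => hCA _
  have hgb : ∀ U, |g U| ≤ CB := fun U => hCB _
  have hcorr : latticeConnectedCorr r.ρ β N A.F B.F m =
      (∫ U, f U * g U ∂(wilsonMeasure (d := 4) (L := N) r.ρ β)) -
        (∫ U, f U ∂(wilsonMeasure (d := 4) (L := N) r.ρ β)) *
          ∫ U, g U ∂(wilsonMeasure (d := 4) (L := N) r.ρ β) := by
    unfold latticeConnectedCorr
    rw [← integral_comp_configShift_torusLift r.ρ β N B.F v]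
  -- cells of the two supports
  set cA : CoarseIdx μ := fun i => q i 0 with hcA
  set cB : CoarseIdx μ := fun i => q i (x₂ i) with hcB
  have harc : ∀ z : ℤ, |z| ≤ w → ∃ j : ℕ, j ≤ 2 * w ∧
      ((z : ℤ) : ZMod N) = 0 - (w : ZMod N) + (j : ZMod N) := by
    intro z hz
    obtain ⟨hlo, hhi⟩ := abs_le.1 hz
    obtain ⟨j, hj⟩ : ∃ j : ℕ, (j : ℤ) = z + w := ⟨(z + w).toNat, Int.toNat_of_nonneg (by omega)⟩
    refine ⟨j, by omega, ?_⟩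
    calc ((z : ℤ) : ZMod N) = (((z + w : ℤ)) : ZMod N) - (w : ZMod N) := by push_cast; ring
      _ = (j : ZMod N) - (w : ZMod N) := by rw [← hj, Int.cast_natCast]
      _ = 0 - (w : ZMod N) + (j : ZMod N) := by ring
  have hcellA : ∀ e ∈ A.supp, cellOf q (torusEdge N e) = cA := by
    intro e he
    funext i
    obtain ⟨j, hj, hje⟩ := harc (e.1 i) (hwA e he i)
    show q i (((e.1 i : ℤ) : ZMod N)) = q i 0
    rw [hje, harcA i j hj]
  have hcellB : ∀ e ∈ B.supp, cellOf q (torusEdge N (e.1 - v, e.2)) = cB := by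
    intro e he
    funext i
    obtain ⟨j, hj, hje⟩ := harc (e.1 i) (hwB e he i)
    show q i ((((e.1 - v) i : ℤ) : ZMod N)) = q i (x₂ i)
    have : ((((e.1 - v) i : ℤ) : ZMod N)) = x₂ i - (w : ZMod N) + (j : ZMod N) := by
      simp only [hv, Pi.sub_apply, Pi.neg_apply, sub_neg_eq_add, Int.cast_add, hje, hx₂,
        Literature.Probability.LatticeModels.Torus.proj_apply]
      ring
    rw [this, harcB i j hj]
  set EA : Finset (Edge 4 N) := A.supp.image (torusEdge N) with hEA
  set EB : Finset (Edge 4 N) :=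
    (B.supp.image fun e : Literature.MathematicalPhysics.QuantumLattice.ZdEdge 4 =>
      (e.1 - v, e.2)).image (torusEdge N) with hEB
  have hfdepE : DependsOn f (↑EA : Set (Edge 4 N)) := dependsOn_comp_torusLift A.isCylinder N
  have hgdepE : DependsOn g (↑EB : Set (Edge 4 N)) :=
    dependsOn_comp_torusLift (IsCylinder.comp_configShift B.isCylinder v) N
  have hcardA : EA.card ≤ s := Finset.card_image_le.trans hsA
  have hcardB : EB.card ≤ s := Finset.card_image_le.trans (Finset.card_image_le.trans hsB)
  have hcellA' : ∀ e ∈ EA, cellOf q e = cA := by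
    intro e he
    obtain ⟨e₀, he₀, rfl⟩ := Finset.mem_image.1 he
    exact hcellA e₀ he₀
  have hcellB' : ∀ e ∈ EB, cellOf q e = cB := by
    intro e he
    obtain ⟨e₁, he₁, rfl⟩ := Finset.mem_image.1 he
    obtain ⟨e₀, he₀, rfl⟩ := Finset.mem_image.1 he₁
    exact hcellB e₀ he₀
  have hfdep : DependsOn f {v | cellOf q v = cA} := hfdepE.mono fun v hv => hcellA' v hv
  have hgdep : DependsOn g {v | cellOf q v = cB} := hgdepE.mono fun v hv => hcellB' v hv
  -- the time axis: `m ≤ 2b (cdist c_A c_B + 1)`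
  have hx₂0 : x₂ 0 = (m : ZMod N) := by
    simp [hx₂, Literature.Probability.LatticeModels.Torus.proj_apply]
  have htime := hTF.1 N b (μ 0) (q 0) inferInstance hb1 (hframe 0) 0 (x₂ 0)
  have hmh : m ≤ N / 2 := by omega
  have hmval : ((x₂ 0 - 0).valMinAbs).natAbs = m := by
    rw [sub_zero, hx₂0, ZMod.valMinAbs_natCast_of_le_half hmh, Int.natAbs_natCast]
  have hℓ : ((q 0 (x₂ 0) - q 0 0).valMinAbs).natAbs ≤ cdist cA cB := by
    rw [cdist_comm]
    exact natAbs_valMinAbs_sub_le_cdist cB cA 0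
  have hmb : m ≤ 2 * b * (cdist cA cB + 1) :=
    calc m = ((x₂ 0 - 0).valMinAbs).natAbs := hmval.symm
      _ ≤ 2 * b * (((q 0 (x₂ 0) - q 0 0).valMinAbs).natAbs + 1) := htime
      _ ≤ 2 * b * (cdist cA cB + 1) := Nat.mul_le_mul_left _ (Nat.succ_le_succ hℓ)
  have hb0 : (0 : ℝ) < b := by exact_mod_cast hb1
  have hmbR : (m : ℝ) ≤ 2 * b * (cdist cA cB + 1) := by exact_mod_cast hmb
  have hxle : x ≤ κ * ((cdist cA cB : ℝ) + 1) / 2 := by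
    refine hx.trans ?_
    rw [div_le_div_iff₀ (by positivity) two_pos]
    have := mul_le_mul_of_nonneg_left hmbR hκ
    nlinarith [this]
  have hP0 : 0 ≤ 2 * (CA * CB) + C₀ * |Ks * CA| * |Ks * CB| := by positivity
  rw [hcorr]
  rcases le_or_gt (cdist cA cB) (2 * n₀ + 2) with hnear | hfar
  · -- NEAR case: the trivial bound
    have h1 := abs_corr_le_two_mul (wilsonMeasure (d := 4) (L := N) r.ρ β) hfb hgb
    have hxE : x ≤ κ * (2 * n₀ + 3) / 2 := by
      refine hxle.trans ?_
      have h2 : (cdist cA cB : ℝ) + 1 ≤ 2 * n₀ + 3 := by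
        exact_mod_cast (by omega : cdist cA cB + 1 ≤ 2 * n₀ + 3)
      have h3 := mul_le_mul_of_nonneg_left h2 hκ
      linarith
    have hone : 1 ≤ Real.exp (κ * (2 * n₀ + 3) / 2) * Real.exp (-x) := by
      rw [← Real.exp_add]
      exact Real.one_le_exp (by linarith)
    calc |(∫ U, f U * g U ∂(wilsonMeasure (d := 4) (L := N) r.ρ β)) -
          (∫ U, f U ∂(wilsonMeasure (d := 4) (L := N) r.ρ β)) *
            ∫ U, g U ∂(wilsonMeasure (d := 4) (L := N) r.ρ β)|
        ≤ 2 * (CA * CB) := h1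
      _ ≤ (2 * (CA * CB) + C₀ * |Ks * CA| * |Ks * CB|) * 1 := by
          rw [mul_one]
          exact le_add_of_nonneg_right (by positivity)
      _ ≤ (2 * (CA * CB) + C₀ * |Ks * CA| * |Ks * CB|) *
            (Real.exp (κ * (2 * n₀ + 3) / 2) * Real.exp (-x)) := mul_le_mul_of_nonneg_left hone hP0
      _ = _ := by ring
  · -- FAR case: the tower identity and the engine
    obtain ⟨δA, hLipA, -, hSA⟩ := hRC cA f EA CA hcardA hcellA' hfdepE hfm hfb
    obtain ⟨δB, hLipB, -, hSB⟩ := hRC cB g EB CB hcardB hcellB' hgdepE hgm hgb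
    have h1 := abs_corr_le_far hT hC₀ hEng (cellOf q) (orbitWeight r α q) (torusYM r.ρ β N) kp hμ hγ
      hKR _ hGibbs hfm hgm hfb hgb hfdep hgdep (by omega) hLipA hLipB hSA hSB
    have hKB0 : 0 ≤ Ks * CB := (Finset.sum_nonneg fun y _ => hLipB.nonneg y).trans hSB
    have hD : ((cdist cA cB - (2 * n₀ + 2) : ℕ) : ℝ) = cdist cA cB - (2 * n₀ + 2) := by
      rw [Nat.cast_sub (by omega)]
      push_cast
      ring
    have hexp : Real.exp (-(κ * ((cdist cA cB - (2 * n₀ + 2) : ℕ) : ℝ))) ≤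
        Real.exp (κ * (2 * n₀ + 3) / 2) * Real.exp (-x) := by
      rw [← Real.exp_add, Real.exp_le_exp, hD]
      have hdpos : (0 : ℝ) ≤ (cdist cA cB : ℝ) - (2 * n₀ + 2) := by
        have : ((2 * n₀ + 3 : ℕ) : ℝ) ≤ cdist cA cB := by exact_mod_cast hfar
        push_cast at this
        linarith
      nlinarith [mul_nonneg hκ hdpos]
    calc |(∫ U, f U * g U ∂(wilsonMeasure (d := 4) (L := N) r.ρ β)) -
          (∫ U, f U ∂(wilsonMeasure (d := 4) (L := N) r.ρ β)) *
            ∫ U, g U ∂(wilsonMeasure (d := 4) (L := N) r.ρ β)|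
        ≤ C₀ * (Ks * CA) * (Ks * CB) * Real.exp (-(κ * ((cdist cA cB - (2 * n₀ + 2) : ℕ) : ℝ))) := h1
      _ ≤ C₀ * |Ks * CA| * |Ks * CB| * Real.exp (-(κ * ((cdist cA cB - (2 * n₀ + 2) : ℕ) : ℝ))) := by
          apply mul_le_mul_of_nonneg_right _ (Real.exp_pos _).le
          exact mul_le_mul (mul_le_mul_of_nonneg_left (le_abs_self _) hC₀) (le_abs_self _) hKB0
            (mul_nonneg hC₀ (abs_nonneg _))
      _ ≤ C₀ * |Ks * CA| * |Ks * CB| * (Real.exp (κ * (2 * n₀ + 3) / 2) * Real.exp (-x)) :=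
          mul_le_mul_of_nonneg_left hexp (by positivity)
      _ ≤ (2 * (CA * CB) + C₀ * |Ks * CA| * |Ks * CB|) *
            (Real.exp (κ * (2 * n₀ + 3) / 2) * Real.exp (-x)) := by
          apply mul_le_mul_of_nonneg_right _ (by positivity)
          nlinarith [mul_nonneg hCA0 hCB0]
      _ = _ := by ring

end Torus

/-! ### §F The stub -/

/-- **stub_smoothingToGap** — DEPLOYMENT ON THE SYMMETRIC TORUS (`G`-blind, does not use `β_k → ∞`).
Given the engine (`KREngine`), the frames (`TorusFramesExist`), the window-averaging toolkit
(`SpecificationTower`), the DLR description of Wilson's torus measure (`WilsonTorusDLR`) and the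
orbit–Kantorovich windows along the scheme (`OrbitKRWindowsAlong`: scale `t`, radius `n₀`, ratio `γ₀`,
resolution `α`, rough-centre constants `K_s`), the crux's lattice half holds with `Δ = κ(n₀, γ₀, 1)/(4t)`:
fix species `A, B` (supports of `≤ s` edges inside the cube `[-w, w]⁴`); eventually in `k` the physics input
holds at `s`, `b_k = t·M^{n_k} ≥ 4w + 4` (`M^{n_k} → ∞`, `tendsto_natPow_of_shape`) and
`(2n₀+3)·2b_k ≤ L_k ≤ 2S+1` (`a_k L_k → ∞`); then `abs_latticeConnectedCorr_le` on the torus of side `2S+1` with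
`x = Δ a_k m = κ m/(4 b_k)` gives the clause of `HasLatticeMassGap` with the `k`-uniform constant
`(2‖A‖‖B‖ + C₀ |K_s‖A‖| |K_s‖B‖|) e^{κ(2n₀+3)/2}`. -/
theorem stub_smoothingToGap :
    ∀ (G : Type) [Group G] [TopologicalSpace G] [IsTopologicalGroup G] [CompactSpace G]
      [MeasurableSpace G] [BorelSpace G] (r : LatticeRep G) (M : ℕ) (sch : SpeciesScheme (YMSpecies G))
      (n : ℕ → ℕ), 2 ≤ M → (∀ k, sch.a k = ((M : ℝ) ^ n k)⁻¹) →
      KREngine → TorusFramesExist → SpecificationTower → WilsonTorusDLR r → OrbitKRWindowsAlong r M sch n →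
        ∃ Δ : ℝ, 0 < Δ ∧ HasLatticeMassGap r sch Δ := by
  intro G _ _ _ _ _ _ r M sch n hM hshape hE hTF hT hDLR hW
  obtain ⟨t, n₀, γ₀, α, K, ht, hγ₀, hγ₀1, -, hWs⟩ := hW
  obtain ⟨κ, C₀, hκ, hC₀, hEng⟩ := hE n₀ γ₀ 1 hγ₀ hγ₀1 zero_le_one
  have ht0 : (0 : ℝ) < t := by exact_mod_cast ht
  refine ⟨κ / (4 * t), div_pos hκ (by positivity), fun A B => ?_⟩
  obtain ⟨CA, hCA⟩ := A.bounded
  obtain ⟨CB, hCB⟩ := B.bounded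
  -- support radius `w` and support size `s` of the two species
  set w : ℕ := (A.supp ∪ B.supp).sup fun e => Finset.univ.sup fun i : Fin 4 => (e.1 i).natAbs with hw
  have hwAB : ∀ e ∈ A.supp ∪ B.supp, ∀ i, |e.1 i| ≤ (w : ℤ) := by
    intro e he i
    have h1 : (e.1 i).natAbs ≤ Finset.univ.sup (fun j : Fin 4 => (e.1 j).natAbs) :=
      Finset.le_sup (f := fun j : Fin 4 => (e.1 j).natAbs) (Finset.mem_univ i)
    have h2 : Finset.univ.sup (fun j : Fin 4 => (e.1 j).natAbs) ≤ w :=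
      Finset.le_sup (f := fun e : Literature.MathematicalPhysics.QuantumLattice.ZdEdge 4 =>
        Finset.univ.sup fun j : Fin 4 => (e.1 j).natAbs) he
    rw [Int.abs_eq_natAbs]
    exact_mod_cast h1.trans h2
  have hwA : ∀ e ∈ A.supp, ∀ i, |e.1 i| ≤ (w : ℤ) := fun e he => hwAB e (Finset.mem_union_left _ he)
  have hwB : ∀ e ∈ B.supp, ∀ i, |e.1 i| ≤ (w : ℤ) := fun e he => hwAB e (Finset.mem_union_right _ he)
  set s : ℕ := max A.supp.card B.supp.card with hs
  refine ⟨(2 * (CA * CB) + C₀ * |K s * CA| * |K s * CB|) * Real.exp (κ * (2 * n₀ + 3) / 2), ?_⟩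
  have E2 : ∀ᶠ k in atTop, ((4 * w + 4 : ℕ) : ℝ) ≤ (M : ℝ) ^ n k :=
    (tendsto_natPow_of_shape sch hshape).eventually_ge_atTop _
  have E3 : ∀ᶠ k in atTop, ((2 * (2 * n₀ + 3) * t : ℕ) : ℝ) ≤ sch.a k * sch.L k :=
    sch.tendsto_L.eventually_ge_atTop _
  filter_upwards [hWs s, E2, E3] with k hk1 hk2 hk3 S hS m hm
  have hb4 : 4 * w + 4 ≤ t * M ^ n k := by
    have h1 : 4 * w + 4 ≤ M ^ n k := by exact_mod_cast hk2
    exact h1.trans (Nat.le_mul_of_pos_left _ (by omega))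
  have hb1 : 1 ≤ t * M ^ n k := le_trans (by omega) hb4
  have hL : M ^ n k * (2 * (2 * n₀ + 3) * t) ≤ sch.L k := by
    rw [hshape k] at hk3
    have hc : (0 : ℝ) < (M : ℝ) ^ n k := by positivity
    have := (le_inv_mul_iff₀ hc).1 hk3
    exact_mod_cast this
  have hbN : (2 * n₀ + 3) * (2 * (t * M ^ n k)) ≤ 2 * S + 1 :=
    calc (2 * n₀ + 3) * (2 * (t * M ^ n k)) = M ^ n k * (2 * (2 * n₀ + 3) * t) := by ring
      _ ≤ sch.L k := hL
      _ ≤ S := hS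
      _ ≤ 2 * S + 1 := by omega
  have hmN : 2 * m < 2 * S + 1 := by omega
  obtain ⟨hγ, hGibbs⟩ := hDLR (sch.β k) (2 * S + 1)
  have hx : κ / (4 * t) * (sch.a k * m) ≤ κ * m / (4 * ((t * M ^ n k : ℕ) : ℝ)) := by
    rw [hshape k]
    have hc : (0 : ℝ) < (M : ℝ) ^ n k := by positivity
    apply le_of_eq
    push_cast
    field_simp
  exact abs_latticeConnectedCorr_le hTF hT hκ.le hC₀ hEng r (sch.β k) (α k) (K s) s (2 * S + 1)
    (t * M ^ n k) w m A B hCA hCB (le_max_left _ _) (le_max_right _ _) hwA hwB hb1 hb4 hbN hmN hγ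
    hGibbs (hk1 S hS) hx

end

end Summit.QuantumFields.YangMills.Cruxes.LatticeGapOnTrajectory.OrbitKantorovichFiniteSize
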